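import Summits.HubbardSuperconductivity.HubbardSuperconductivity.Theses.ParityGapRigidity
import Summits.HubbardSuperconductivity.HubbardSuperconductivity.Theses.FluxSpectroscopy
import Literature.MathematicalPhysics.QuantumLattice.HubbardTorusFlux
import Summits.HubbardSuperconductivity.HubbardSuperconductivity.Theorems.ParityGapRigidityIncommensurateRigidityStubUniformYangUpgrade
import HarnessLib

/-!
# Reduction of the crux `IncommensurateRigidity` (stmt-HubbardSuperconductivity-2195) to the
# Kohn–SWZ flux criterion plus the programme's flux bridge (stmt-1817)

**What.** The kernel-checked COMPOSITION of line `registered` (skeleton r2,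
`Cruxes/IncommensurateRigidity/Lines/birth.lean`, sha 6e13bdfcd5de…) of the crux
`Summit.HubbardSuperconductivity.HubbardSuperconductivity.Theses.ParityGapRigidity.IncommensurateRigidity`
(route ParityGapRigidity, rank-2 bet: a converse Lieb–Schultz–Mattis statement — (H1) exponentially
decaying `ρ₁`, (H2) normal one-body fluctuations, (H3) at most `D` in-sector levels below `E₀ + c/L`,
(H4) soft pair staircase, at non-integer filling `1 - δ`, imply uniform Yang ODLRO `a L² ≤ Re v†ρ₂v`),
landed as an importable theorem instead of a `sorry`-carrying workfile:

  `incommensurateRigidity_of_kohnStiffnessFC :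
      KohnStiffnessFC-statement → FluxSpectroscopy.FluxBridge → IncommensurateRigidity`.

Here the first hypothesis is the line's ONE open registered stub `stub_kohnStiffnessFC`, stated
verbatim (registered signature, skeleton sha 6e13bdfc): for all `U > 0`, `δ ∈ (0, 1/2)`,
(H1) → (H2) → (H3) → (H4) → `FC_T(U, δ)`, where `FC_T(U, δ)` is the flux criterion of route
FluxSpectroscopy over the named flux envelope `fluxEnergy L U δ θ` (lowest energy of the seam-twisted
torus `hubbardTorusFlux L U θ` in the `(N_L, S^z = 0)` sector, `N_L = 2⌊(1-δ)L²/2⌋`):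
`∃ ρ > 0`, eventually in even `L`, `ρ θ² ≤ fluxEnergy L U δ θ - fluxEnergy L U δ 0` for `|θ| ≤ π/2`.
The second hypothesis is the crux `FluxBridge` of route FluxSpectroscopy (item
stmt-HubbardSuperconductivity-1817, open): under `FC_T(U, δ)` every admissible sequence of normalised
sector ground states has, eventually in even `L`, a unit eigenvector of `ρ₂` with eigenvalue `≥ c N_L`.
The glue — `FluxBridge`'s sequence-wise conclusion upgraded to the crux's UNIFORM conclusion — is the
landed stub `Summit.HubbardSuperconductivity.IncommensurateRigidity.Birth.stub_uniformYangUpgrade`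
(`Theorems/ParityGapRigidityIncommensurateRigidityStubUniformYangUpgrade.lean`, p151487).

**Why land it.** Six line leads (c1–c6, 2026-08-17) found the stub to be the crux's entire
difficulty: a stiffness FLOOR from spectral/clustering data at non-integer filling, for which no
theorem exists in print or in the tree (flux insertion, momentum counting, index theorems,
quasi-adiabatic continuation, Bloch/Bogoliubov bounds all give ceilings or commensurability; see
`Cruxes/IncommensurateRigidity/Lines/registered-dead*.md`). This file records, as a citable theorem,
exactly what the line DOES prove: stmt-2195 follows verbatim from that one statement and stmt-1817.
If the planner files the stub statement as a hypothesis/conjecture item `H_R` (or a prover ever proves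
it), the closing file of stmt-2195 is `incommensurateRigidity_of_kohnStiffnessFC H_R_holds FluxBridge_holds`.

**Proof.** Unfold the crux; given `U, δ, hU, hδ` and (H1)–(H4), the first hypothesis yields
`FC_T(U, δ)`, and `stub_uniformYangUpgrade hFB U δ hU hδ` turns it into the crux's conclusion, which is
the uniform Yang ODLRO clause by `rfl`. Pointwise companion: `yangODLRO_of_fluxCriterion` — at a FIXED
`(U, δ)`, `FluxBridge` and `FC_T(U, δ)` alone give the crux's conclusion there (no (H1)–(H4) needed),
which is the form route ParityGapRigidity's window actually consumes.
-/

noncomputable section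

namespace Summit.HubbardSuperconductivity.IncommensurateRigidity.Birth

open Literature.MathematicalPhysics.QuantumLattice Filter
open scoped BigOperators ComplexOrder

/-- **Pointwise flux route to the crux's conclusion.** At a fixed `U > 0`, `δ ∈ (0, 1/2)`: the flux
bridge `FluxSpectroscopy.FluxBridge` (stmt-1817, hypothesis) and the flux criterion `FC_T(U, δ)`
(hypothesis) give the conclusion of `IncommensurateRigidity` AT `(U, δ)` — uniform Yang ODLRO of every
normalised `(N_L, 0)`-sector ground state of `hubbardTorus 2 L 1 U` for all large even `L` — with no use
of (H1)–(H4). (A restatement of the landed glue `stub_uniformYangUpgrade` with the hypotheses in the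
order a window argument supplies them.) -/
theorem yangODLRO_of_fluxCriterion (U δ : ℝ) (hU : 0 < U) (hδ : δ ∈ Set.Ioo (0 : ℝ) (1 / 2))
    (hFB : Summit.HubbardSuperconductivity.HubbardSuperconductivity.Theses.FluxSpectroscopy.FluxBridge)
    (hFC : ∃ ρ : ℝ, 0 < ρ ∧ ∀ᶠ L : ℕ in atTop, ∀ [NeZero L], Even L → ∀ θ : ℝ, |θ| ≤ Real.pi / 2 →
      ρ * θ ^ 2 ≤ fluxEnergy L U δ θ - fluxEnergy L U δ 0) :
    ∃ a : ℝ, 0 < a ∧ ∃ L₁ : ℕ, ∀ L ≥ L₁, Even L → ∀ Hm, Hm = hubbardTorus 2 L 1 U → ∀ ψ,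
      IsGroundStateInSector Hm (2 * ⌊(1 - δ) * (L : ℝ) ^ 2 / 2⌋₊) 0 ψ → star ψ ⬝ᵥ ψ = 1 →
      ∃ v : Orb (FermionTorus 2 L) × Orb (FermionTorus 2 L) → ℂ,
        star v ⬝ᵥ v = 1 ∧ a * (L : ℝ) ^ 2 ≤ (star v ⬝ᵥ Matrix.mulVec (twoParticleRDM ψ) v).re :=
  stub_uniformYangUpgrade hFB U δ hU hδ hFC

/-- **Reduction of stmt-2195 (line `registered`, skeleton r2).** The crux
`ParityGapRigidity.IncommensurateRigidity` follows from
(A) the Kohn–Scalapino–White–Zhang form of the converse Lieb–Schultz–Mattis statement — the line's one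
open registered stub `stub_kohnStiffnessFC`, verbatim: for all `U > 0`, `δ ∈ (0, 1/2)`,
(H1) → (H2) → (H3) → (H4) → `FC_T(U, δ)` (uniform stiffness `ρ θ² ≤ E^T_L(θ) - E^T_L(0)` of the flux
envelope `fluxEnergy` up to `|θ| ≤ π/2`, eventually in even `L`) — and
(B) the flux bridge `FluxSpectroscopy.FluxBridge` (item stmt-HubbardSuperconductivity-1817).
Both are HYPOTHESES here (neither is proved anywhere); the theorem is the composition only:
unfold the crux, feed (H1)–(H4) to (A), and upgrade (B) with the landed glue `stub_uniformYangUpgrade`. -/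
theorem incommensurateRigidity_of_kohnStiffnessFC :
    (∀ (U δ : ℝ), 0 < U → δ ∈ Set.Ioo (0 : ℝ) (1 / 2) →
      (∃ C m : ℝ, 0 < m ∧ ∃ L₀ : ℕ, ∀ L ≥ L₀, Even L → ∀ Hm, Hm = hubbardTorus 2 L 1 U → ∀ ψ,
        IsGroundStateInSector Hm (2 * ⌊(1 - δ) * (L : ℝ) ^ 2 / 2⌋₊) 0 ψ → star ψ ⬝ᵥ ψ = 1 →
        ∀ (x y : FermionTorus 2 L) (σ τ : Fin 2),
          ‖oneParticleRDM ψ (orb x σ) (orb y τ)‖ ≤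
            C * Real.exp (-(m * (torusDist x.toTorusSite y.toTorusSite : ℝ)))) →
      (∃ C : ℝ, ∃ L₀ : ℕ, ∀ L ≥ L₀, Even L → ∀ Hm, Hm = hubbardTorus 2 L 1 U → ∀ ψ,
        IsGroundStateInSector Hm (2 * ⌊(1 - δ) * (L : ℝ) ^ 2 / 2⌋₊) 0 ψ → star ψ ⬝ᵥ ψ = 1 →
        ∀ a : Orb (FermionTorus 2 L) × Orb (FermionTorus 2 L) → ℂ, (∀ p, ‖a p‖ ≤ 1) →
          (∀ p, a p ≠ 0 → torusDist (ofLex p.1).1.toTorusSite (ofLex p.2).1.toTorusSite ≤ 1) →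
          (expect (Matrix.conjTranspose (∑ p, a p • (creation p.1 * annihilation p.2)) *
              (∑ p, a p • (creation p.1 * annihilation p.2))) ψ).re -
            ‖expect (∑ p, a p • (creation p.1 * annihilation p.2)) ψ‖ ^ 2 ≤ C * (L : ℝ) ^ 2) →
      (∃ c : ℝ, 0 < c ∧ ∃ D L₀ : ℕ, ∀ L ≥ L₀, Even L → ∀ Hm, Hm = hubbardTorus 2 L 1 U →
        ∀ V : Submodule ℂ (Fock (Orb (FermionTorus 2 L))),
          V ≤ szSector (2 * ⌊(1 - δ) * (L : ℝ) ^ 2 / 2⌋₊) 0 →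
          (∀ φ ∈ V, (star φ ⬝ᵥ Matrix.mulVec Hm φ).re ≤
            (Matrix.minEnergyOn Hm (szSector (2 * ⌊(1 - δ) * (L : ℝ) ^ 2 / 2⌋₊) 0) + c / (L : ℝ)) *
              (star φ ⬝ᵥ φ).re) →
          Module.finrank ℂ V ≤ D) →
      (∃ C : ℝ, ∃ L₀ : ℕ, ∀ L ≥ L₀, Even L → ∀ Hm, Hm = hubbardTorus 2 L 1 U →
        ∀ (E : ℕ → ℝ) (n : ℕ), E = groundEnergy Hm → n = 2 * ⌊(1 - δ) * (L : ℝ) ^ 2 / 2⌋₊ →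
          E (n + 2) - (E n + E (n + 4)) / 2 ≤ C / (L : ℝ) ^ 2 ∧
            E (n - 2) - (E n + E (n - 4)) / 2 ≤ C / (L : ℝ) ^ 2) →
      ∃ ρ : ℝ, 0 < ρ ∧ ∀ᶠ L : ℕ in atTop, ∀ [NeZero L], Even L → ∀ θ : ℝ, |θ| ≤ Real.pi / 2 →
        ρ * θ ^ 2 ≤ fluxEnergy L U δ θ - fluxEnergy L U δ 0) →
    Summit.HubbardSuperconductivity.HubbardSuperconductivity.Theses.FluxSpectroscopy.FluxBridge →
    Summit.HubbardSuperconductivity.HubbardSuperconductivity.Theses.ParityGapRigidity.IncommensurateRigidity := by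
  intro hA hFB U δ hU hδ h1 h2 h3 h4
  exact yangODLRO_of_fluxCriterion U δ hU hδ hFB (hA U δ hU hδ h1 h2 h3 h4)

end Summit.HubbardSuperconductivity.IncommensurateRigidity.Birth

end
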